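import Summits.CriticalPhenomena.PercolationContinuityZ3.Theorems.PercNearOneGluingNoHeavyLowerTailKnQuestion8AntitheticTwin
import HarnessLib

/-!
# `NoHeavyLowerTail` (crux stmt-CriticalPhenomena-4575), antithetic vdBHK programme: the PENDANT ATOM — the colouring-level dictionary of `Ω_{Q + v}` for a
# new minimal element `v` below an ARBITRARY set `U ⊆ Q` (the nest-point step of CONJECTURE Cβ; generalises `AntitheticTwin`, where `U = ↑°u`)

Support file (seat `prim-ineq-gen-7` gen 57; `--supports stmt-CriticalPhenomena-4575`).  No `sorry`, no definitions.  Memo: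
run/shared/lean/prim/prim-ineq-gen-7/FINDING-NEST-g57.md §1–2 (THEOREM NP-RED: CONJECTURE Cβ ⟺ 'adding a pendant nest atom preserves antipodal Kleitman';
STRUCTURE THEOREM of the pendant atom).

SETTING (hypothesis style of `AntitheticHat` / `AntitheticInsertion` / `AntitheticTwin`).  `E` is the ground set of a finite poset `Q`, `down e` the strict
down-sets, `U : E → Prop` ANY predicate (in the application the strict up-set `↑°v` of the new atom: an up-set of `Q` avoiding the minimal elements, whose
atom sets form a chain — none of this is needed for the dictionary).  The new element `v = none : Option E` is an atom, `↓°v = ∅` (`hdZn`), and lies below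
exactly the elements of `U`: `↓°(some e) = some″↓°e`, plus `v` iff `U e` (`hdZs`).  `leT`, `leZ` are the explicit colouring orders of `Q` and `Q + v` (the three
conditions of FINDING-MULTISINK-g44 §0′: red interiors shrink, blue interiors grow, a red → blue flip is interior on both sides; `true` = red).
* `AntitheticPendantAtom.le_iff_pendant` — THE DICTIONARY: `leZ t t′` iff (o) `v` is not recoloured blue → red, and (i)–(iii) the three conditions of `Q` hold for
  the restrictions with 'interior at `e`' STRENGTHENED, for `e ∈ U`, by 'and `v` has the colour of `e`'.  Read with the sign model (FINDING-TWIN-g56 §0a):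
  adding `v` DEMOTES, in the fibre `{v red}`, every blue-interior element of `U` to blue-non-interior and, in the fibre `{v blue}`, every red-interior element of
  `U` to red-non-interior, and changes nothing else (STRUCTURE THEOREM, memo §2).
* `AntitheticPendantAtom.le_iff_isolated` — `U = ∅` (an isolated new atom): `leZ t t′` iff (o) and `leT s s′` — the product `Ω_Q × C₂`.
The two other kernel dictionaries of this step are the special cases `U = ↑°u` (`AntitheticTwin`: the twin of the atom `u`) and `U = {t}` with `t` a new
top over a down-set (`AntitheticZoneColouring`, this generation: the four sheets of the zone extension `T_Z(Ω_Q)`).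
-/

namespace Summit.CriticalPhenomena.PercolationContinuityZ3.Theorems

open Finset

namespace AntitheticPendantAtom

variable {E : Type*}

/-- **PENDANT-ATOM DICTIONARY.**  For colourings `t, t′` of `Q + v` with restrictions `s, s′` to `Q` and `v`-colours `t none`, `t′ none`: `leZ t t′` holds iff
`v` is not recoloured blue → red and the three order conditions of `Q` hold for `s, s′` with the interior predicate at every `e ∈ U` strengthened by
'`v` carries the colour of `e`'. [this work] -/
theorem le_iff_pendant (down : E → Finset E) (U : E → Prop)
    (downZ : Option E → Finset (Option E)) (hdZn : ∀ o, o ∉ downZ none)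
    (hdZs : ∀ e o, o ∈ downZ (some e) ↔ (∃ d ∈ down e, o = some d) ∨ (o = none ∧ U e))
    (leZ : (Option E → Bool) → (Option E → Bool) → Prop)
    (hleZ : ∀ s t, leZ s t ↔
      ((∀ o, (t o = true ∧ ∀ d ∈ downZ o, t d = true) → (s o = true ∧ ∀ d ∈ downZ o, s d = true)) ∧
       (∀ o, (s o = false ∧ ∀ d ∈ downZ o, s d = false) → (t o = false ∧ ∀ d ∈ downZ o, t d = false)) ∧
       (∀ o, s o = true → t o = false → ((∀ d ∈ downZ o, s d = true) ∧ (∀ d ∈ downZ o, t d = false)))))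
    (s s' : E → Bool) (t t' : Option E → Bool) (hts : ∀ e, t (some e) = s e) (hts' : ∀ e, t' (some e) = s' e) :
    leZ t t' ↔
      ((t none = false → t' none = false) ∧
       (∀ e, (s' e = true ∧ (∀ d ∈ down e, s' d = true) ∧ (U e → t' none = true)) →
             (s e = true ∧ (∀ d ∈ down e, s d = true) ∧ (U e → t none = true))) ∧
       (∀ e, (s e = false ∧ (∀ d ∈ down e, s d = false) ∧ (U e → t none = false)) →
             (s' e = false ∧ (∀ d ∈ down e, s' d = false) ∧ (U e → t' none = false))) ∧
       (∀ e, s e = true → s' e = false →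
             (((∀ d ∈ down e, s d = true) ∧ (U e → t none = true)) ∧ ((∀ d ∈ down e, s' d = false) ∧ (U e → t' none = false))))) := by
  have HS := AntitheticInsertion.forall_downZ_some_ins down U downZ hdZs
  have HN := AntitheticTwin.forall_downZ_none_twin downZ hdZn
  rw [hleZ]
  constructor
  · rintro ⟨h1, h2, h3⟩
    refine ⟨?_, fun e => ?_, fun e => ?_, fun e => ?_⟩
    · intro hf
      by_contra hne
      have ht' : t' none = true := by cases h : t' none <;> simp_all
      have := (h1 none ⟨ht', by rw [HN]; trivial⟩).1
      rw [hf] at this; exact Bool.false_ne_true this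
    · have h := h1 (some e); simp only [HS, hts, hts'] at h; exact h
    · have h := h2 (some e); simp only [HS, hts, hts'] at h; exact h
    · have h := h3 (some e); simp only [HS, hts, hts'] at h; exact h
  · rintro ⟨h0, h1, h2, h3⟩
    refine ⟨fun o => ?_, fun o => ?_, fun o => ?_⟩
    · cases o with
      | none =>
        simp only [HN, and_true]
        intro ht'
        cases h : t none with
        | false => exact absurd ((h0 h).symm.trans ht') Bool.false_ne_true
        | true => rfl
      | some e => simp only [HS, hts, hts']; exact h1 e
    · cases o with
      | none =>
        simp only [HN, and_true]
        intro ht; exact h0 ht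
      | some e => simp only [HS, hts, hts']; exact h2 e
    · cases o with
      | none =>
        simp only [HN, and_self]
        intro _ _; trivial
      | some e => simp only [HS, hts, hts']; exact h3 e

/-- **ISOLATED NEW ATOM (`U = ∅`).**  If `v` lies below nothing, `leZ t t′` iff `v` is not recoloured blue → red and the three conditions of `Q` hold for the
restrictions verbatim: `Ω_{Q ⊔ v} = Ω_Q × (red < blue)`. [this work] -/
theorem le_iff_isolated (down : E → Finset E)
    (downZ : Option E → Finset (Option E)) (hdZn : ∀ o, o ∉ downZ none)
    (hdZs : ∀ e o, o ∈ downZ (some e) ↔ (∃ d ∈ down e, o = some d) ∨ (o = none ∧ False))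
    (leT : (E → Bool) → (E → Bool) → Prop)
    (hleT : ∀ s t, leT s t ↔
      ((∀ e, (t e = true ∧ ∀ d ∈ down e, t d = true) → (s e = true ∧ ∀ d ∈ down e, s d = true)) ∧
       (∀ e, (s e = false ∧ ∀ d ∈ down e, s d = false) → (t e = false ∧ ∀ d ∈ down e, t d = false)) ∧
       (∀ e, s e = true → t e = false → ((∀ d ∈ down e, s d = true) ∧ (∀ d ∈ down e, t d = false)))))
    (leZ : (Option E → Bool) → (Option E → Bool) → Prop)
    (hleZ : ∀ s t, leZ s t ↔
      ((∀ o, (t o = true ∧ ∀ d ∈ downZ o, t d = true) → (s o = true ∧ ∀ d ∈ downZ o, s d = true)) ∧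
       (∀ o, (s o = false ∧ ∀ d ∈ downZ o, s d = false) → (t o = false ∧ ∀ d ∈ downZ o, t d = false)) ∧
       (∀ o, s o = true → t o = false → ((∀ d ∈ downZ o, s d = true) ∧ (∀ d ∈ downZ o, t d = false)))))
    (s s' : E → Bool) (t t' : Option E → Bool) (hts : ∀ e, t (some e) = s e) (hts' : ∀ e, t' (some e) = s' e) :
    leZ t t' ↔ ((t none = false → t' none = false) ∧ leT s s') := by
  rw [le_iff_pendant down (fun _ => False) downZ hdZn hdZs leZ hleZ s s' t t' hts hts', hleT]
  simp only [IsEmpty.forall_iff, and_true]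

/-- **THE OUTER PAIR.**  On the colourings in which every element of `U` has the colour OPPOSITE to `v` (the two outer sheets `O₀ = {v red, U blue}` and
`O₁ = {v blue, U red}` of the memo, §5), the order of `Q + v` is: `v` is not recoloured blue → red, and the three conditions of `Q` at the elements OUTSIDE `U`
only (at an element of `U` all three conditions are vacuous).  When `U` is an up-set of `Q` the strict down-set of an element outside `U` avoids `U`, so this
says: `O₀ ∪ O₁` is the product `Ω_{Q∖U} × (red < blue)` — the AK piece whose slack the transfer theorem `AntitheticOuterPair.outer_pair_transfer` spends.
[this work] -/
theorem outer_iff (down : E → Finset E) (U : E → Prop)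
    (downZ : Option E → Finset (Option E)) (hdZn : ∀ o, o ∉ downZ none)
    (hdZs : ∀ e o, o ∈ downZ (some e) ↔ (∃ d ∈ down e, o = some d) ∨ (o = none ∧ U e))
    (leZ : (Option E → Bool) → (Option E → Bool) → Prop)
    (hleZ : ∀ s t, leZ s t ↔
      ((∀ o, (t o = true ∧ ∀ d ∈ downZ o, t d = true) → (s o = true ∧ ∀ d ∈ downZ o, s d = true)) ∧
       (∀ o, (s o = false ∧ ∀ d ∈ downZ o, s d = false) → (t o = false ∧ ∀ d ∈ downZ o, t d = false)) ∧
       (∀ o, s o = true → t o = false → ((∀ d ∈ downZ o, s d = true) ∧ (∀ d ∈ downZ o, t d = false)))))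
    (s s' : E → Bool) (t t' : Option E → Bool) (hts : ∀ e, t (some e) = s e) (hts' : ∀ e, t' (some e) = s' e)
    (hO : ∀ e, U e → s e = !(t none)) (hO' : ∀ e, U e → s' e = !(t' none)) :
    leZ t t' ↔
      ((t none = false → t' none = false) ∧
       (∀ e, ¬ U e → (s' e = true ∧ ∀ d ∈ down e, s' d = true) → (s e = true ∧ ∀ d ∈ down e, s d = true)) ∧
       (∀ e, ¬ U e → (s e = false ∧ ∀ d ∈ down e, s d = false) → (s' e = false ∧ ∀ d ∈ down e, s' d = false)) ∧
       (∀ e, ¬ U e → s e = true → s' e = false → ((∀ d ∈ down e, s d = true) ∧ (∀ d ∈ down e, s' d = false)))) := by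
  rw [le_iff_pendant down U downZ hdZn hdZs leZ hleZ s s' t t' hts hts']
  constructor
  · rintro ⟨h0, h1, h2, h3⟩
    refine ⟨h0, fun e he hp => ?_, fun e he hp => ?_, fun e he ha hb => ?_⟩
    · have h := h1 e ⟨hp.1, hp.2, fun hu => (he hu).elim⟩; exact ⟨h.1, h.2.1⟩
    · have h := h2 e ⟨hp.1, hp.2, fun hu => (he hu).elim⟩; exact ⟨h.1, h.2.1⟩
    · have h := h3 e ha hb; exact ⟨h.1.1, h.2.1⟩
  · rintro ⟨h0, h1, h2, h3⟩
    refine ⟨h0, fun e hp => ?_, fun e hp => ?_, fun e ha hb => ?_⟩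
    · by_cases he : U e
      · -- vacuous on U: s' e = true forces v' blue, contradicting the third conjunct of the premise
        exfalso
        have h := hO' e he; rw [hp.1, hp.2.2 he] at h; exact absurd h (by decide)
      · have h := h1 e he ⟨hp.1, hp.2.1⟩; exact ⟨h.1, h.2, fun hu => (he hu).elim⟩
    · by_cases he : U e
      · exfalso
        have h := hO e he; rw [hp.1, hp.2.2 he] at h; exact absurd h (by decide)
      · have h := h2 e he ⟨hp.1, hp.2.1⟩; exact ⟨h.1, h.2, fun hu => (he hu).elim⟩
    · by_cases he : U e
      · -- s e = true means v blue in t; s' e = false means v red in t': excluded by (o)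
        exfalso
        have ht : t none = false := by
          have h := hO e he; rw [ha] at h
          cases hh : t none with
          | false => rfl
          | true => rw [hh] at h; exact absurd h (by decide)
        have ht' : t' none = true := by
          have h := hO' e he; rw [hb] at h
          cases hh : t' none with
          | false => rw [hh] at h; exact absurd h (by decide)
          | true => rfl
        have h := h0 ht; rw [ht'] at h; exact absurd h (by decide)
      · have h := h3 e he ha hb; exact ⟨⟨h.1, fun hu => (he hu).elim⟩, ⟨h.2, fun hu => (he hu).elim⟩⟩

end AntitheticPendantAtom

end Summit.CriticalPhenomena.PercolationContinuityZ3.Theorems
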